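import Literature.Geometry.Kaehler.RiemannianHodge
import Literature.Geometry.Kaehler.HodgeStarProofs
import Literature.Geometry.Kaehler.HodgeStarOfVolumeFormProofs
import Mathlib.Topology.Instances.Irrational
import Mathlib.Analysis.SpecialFunctions.Log.Deriv
import HarnessLib

/-!
# A rough metric on `ℝ²`: `mem_harmonicForms_iff` and `isSmoothForm_hodgeStar` fail as stated

This file settles the status of two named facts of
`Literature/Geometry/Kaehler/RiemannianHodge.lean` by an explicit, fully computed counterexample.

## What is refuted, and why it matters

The named facts `Literature.Geometry.Kaehler.mem_harmonicForms_iff` ("`α ∈ harmonicForms o h ↔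
IsHarmonicForm o h α`", Warner, *Foundations of Differentiable Manifolds and Lie Groups*, 6.1 and
Def. 6.7) and `Literature.Geometry.Kaehler.isSmoothForm_hodgeStar` ("`⋆` of a smooth form is
smooth", Warner, 6.1) were sorried *theorems* in a section carrying the smooth-structure instances
`[IsManifold I ∞ M]`, `[IsContinuousRiemannianBundle E _]`, `[IsContMDiffRiemannianBundle I ∞ E _]`;
the M5 migration turned them into `def … : Prop`, and a `def` does not pick up unused section
instances. As vendored they therefore bind only `[RiemannianBundle fun x ↦ TangentSpace I x]`,
Mathlib's fibrewise inner product *of no regularity at all*, and quantify over such metrics.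
In Warner the metric is `C^∞`; for rough metrics both statements are false, so neither
`mem_harmonicForms_iff_holds` nor `isSmoothForm_hodgeStar_holds` can ever be proved:

* `not_forall_mem_harmonicForms_iff`, `not_forall_isSmoothForm_hodgeStar`: the universal
  closures fail (already for `E = H = ℝ × ℝ`, `n = 2`, degrees `k = 0` resp. `k = 1`);
* `RoughMetric.not_mem_harmonicForms_iff`, `RoughMetric.not_isSmoothForm_hodgeStar`: the
  concrete instance.

The positive content for smooth metrics is in
`Literature/Geometry/Kaehler/RiemannianHodgeHarmonic.lean` (`mem_harmonicForms_iff_of_facts`: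
the fact follows from chart independence of `d` and smoothness of `⋆`).

## The counterexample (`namespace RoughMetric`)

On `M = ℝ × ℝ` (model `𝓘(ℝ, ℝ × ℝ)`, standard orientation `stdOrientation`) take the metric
`g = a dx² + a⁻¹ dy²` with conformal-type factor `a (x, y) = exp (switch x)`, where
`switch t = t` for rational `t` and `switch t = 0` for irrational `t` (`roughMetric`, a
`Bundle.RiemannianMetric`; the bundle structure `roughBundle` is a `def` used as a *local*
instance only). Then:

* `a > 0`, `a` is differentiable at **no** point (`not_differentiableAt_factor`, from the
  one-variable `not_differentiableAt_switch`: slopes at `0` are `0` along irrationals and `1`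
  along rationals; elsewhere `switch` is not even continuous), and `a → 1` at the origin.
* `det g = 1`, so the Riemannian volume form is the constant `dx ∧ dy` (`volumeFormL_eq_Ω`) and
  the hypothesis `ho : IsSmoothForm (riemannianVolumeForm o)` of both facts holds
  (`isSmoothForm_riemannianVolumeForm`).
* `⋆` on `1`-forms is `⋆(β₀ dx + β₁ dy) = (β₀ / a) dy - a β₁ dx` (`hodgeStar_oneForm`, via the
  Riesz vector and the proved two-dimensional check `hodgeStar_apply_eq_areaForm_holds`).
* The manifold exterior derivative `mextDeriv` is `fderiv`-based, hence takes the junk value `0`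
  wherever a form-valued map is not differentiable
  (`mextDeriv_eq_zero_of_forall_not_differentiableAt`). For `f₁ = y + x²/2` and `f₂ = -y` the
  `dx`-coefficient of `⋆ d fᵢ` is `∓a`, differentiable nowhere, so `d ⋆ d fᵢ = 0` and
  `Δ fᵢ = -⋆ d ⋆ d fᵢ = 0`: both are "harmonic" (`isHarmonicForm_zeroForm_f₁/₂`).
* Their sum `u = x²/2` has `⋆ d u = (x / a) dy`, which **is** differentiable at the origin with
  derivative `h ↦ h₁ dy` (`hasFDerivAt_factor_inv_mul_fst`, since `1/a → 1`), so
  `d ⋆ d u (0) = dx ∧ dy` and `Δ u (0) = -⋆(dx ∧ dy) ≠ 0`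
  (`hodgeLaplacian_zeroForm_u_apply_zero_ne`, using the proved `⋆⋆ = ±1`,
  `hodgeStar_hodgeStar_holds`). Hence `u ∈ harmonicForms` (a span) but `¬ IsHarmonicForm u`.
* Likewise `dy` is smooth while `⋆ dy = -a dx` is differentiable nowhere, refuting
  `isSmoothForm_hodgeStar`.

## Design notes

* Everything analytic is done in the fixed model fibre `ℝ × ℝ` (`flat α` retypes a form as a
  plain map; `mextDeriv_eq_extDeriv` bridges), everything metric in the tangent spaces
  `TangentSpace 𝓘(ℝ, ℝ × ℝ) p` (local notation `T p`), whose inner product comes from the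
  local instance. Casts between the two use `set_option backward.isDefEq.respectTransparency
  false in`, exactly as Mathlib's `riemannianMetricVectorSpace` does.
* Forms are never compared across two different base points (the bundle instances at `p` and
  `q` are not syntactically related); constants such as `Ω = dx ∧ dy` live in the model fibre.
* No global instance is registered: `roughBundle` and the `Fact (finrank ℝ (ℝ × ℝ) = 2)` are
  local instances of this file.

## References

* F. W. Warner, *Foundations of Differentiable Manifolds and Lie Groups*, GTM 94 (1983), 6.1
  (p. 220: `Δ` is a linear operator on `E^p(M)` — for a smooth metric) and Def. 6.7 (p. 222).
-/

noncomputable section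

open scoped Manifold ContDiff Topology
open Bundle Module Filter Set

namespace Literature.Geometry.Kaehler

namespace RoughMetric

/-! ### The rational switch and the conformal factor -/


/-- The "rational switch" `t ↦ t` on rationals, `t ↦ 0` on irrationals. [folklore] -/
def switch (t : ℝ) : ℝ := (Set.range ((↑) : ℚ → ℝ)).indicator id t

/-- The switch vanishes at irrational points. [folklore] -/
theorem switch_of_irrational {t : ℝ} (ht : Irrational t) : switch t = 0 :=
  Set.indicator_of_notMem ht _

/-- The switch is the identity at rational points. [folklore] -/
theorem switch_of_not_irrational {t : ℝ} (ht : ¬ Irrational t) : switch t = t := by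
  unfold switch
  rw [Set.indicator_of_mem (not_not.1 ht)]
  rfl

/-- `switch 0 = 0`. [folklore] -/
@[simp] theorem switch_zero : switch 0 = 0 := by
  by_cases h : Irrational (0 : ℝ)
  · exact switch_of_irrational h
  · exact switch_of_not_irrational h

/-- `|switch t| ≤ |t|`. [folklore] -/
theorem abs_switch_le (t : ℝ) : |switch t| ≤ |t| := by
  by_cases ht : Irrational t
  · simp [switch_of_irrational ht]
  · simp [switch_of_not_irrational ht]

/-- The switch is continuous at `0` (with value `0`). [folklore] -/
theorem tendsto_switch_zero : Tendsto switch (𝓝 0) (𝓝 0) := by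
  refine squeeze_zero_norm (fun t ↦ ?_) (by simpa using (continuous_norm.tendsto (0 : ℝ)))
  simpa [Real.norm_eq_abs] using abs_switch_le t

/-- The rational switch is differentiable at no point. [folklore] -/
theorem not_differentiableAt_switch (t : ℝ) : ¬ DifferentiableAt ℝ switch t := by
  intro hd
  rcases eq_or_ne t 0 with rfl | ht
  · have hder := hd.hasDerivAt
    rw [hasDerivAt_iff_tendsto_slope] at hder
    set L := deriv switch 0
    -- along the irrationals the slopes vanish
    have hIsub : {x : ℝ | Irrational x} ⊆ {0}ᶜ := fun x hx h0 ↦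
      not_irrational_zero ((mem_singleton_iff.1 h0) ▸ hx)
    have h1 : Tendsto (slope switch 0) (𝓝[{x | Irrational x}] 0) (𝓝 L) :=
      hder.mono_left (nhdsWithin_mono _ hIsub)
    have h1' : Tendsto (slope switch 0) (𝓝[{x | Irrational x}] 0) (𝓝 0) := by
      refine tendsto_const_nhds.congr' ?_
      filter_upwards [self_mem_nhdsWithin] with x hx
      simp [slope_def_field, switch_of_irrational hx]
    haveI : (𝓝[{x : ℝ | Irrational x}] (0 : ℝ)).NeBot :=
      mem_closure_iff_nhdsWithin_neBot.1 (dense_irrational 0)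
    have hL0 : L = 0 := tendsto_nhds_unique h1 h1'
    -- along the nonzero rationals the slopes are `1`
    set K : Set ℝ := Set.range ((↑) : ℚ → ℝ) \ {0}
    have h2 : Tendsto (slope switch 0) (𝓝[K] 0) (𝓝 L) :=
      hder.mono_left (nhdsWithin_mono _ (sdiff_subset_compl _ _))
    have h2' : Tendsto (slope switch 0) (𝓝[K] 0) (𝓝 1) := by
      refine tendsto_const_nhds.congr' ?_
      filter_upwards [self_mem_nhdsWithin] with x hx
      have hx0 : x ≠ 0 := hx.2
      have hxq : ¬ Irrational x := fun h ↦ h hx.1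
      simp [slope_def_field, switch_of_not_irrational hxq, hx0]
    haveI : (𝓝[K] (0 : ℝ)).NeBot :=
      mem_closure_iff_nhdsWithin_neBot.1 ((Rat.denseRange_cast (𝕜 := ℝ)).sdiff_singleton 0 0)
    have hL1 : L = 1 := tendsto_nhds_unique h2 h2'
    exact one_ne_zero (hL1.symm.trans hL0)
  · have hc : Tendsto switch (𝓝 t) (𝓝 (switch t)) := hd.continuousAt
    have hq : Tendsto switch (𝓝[Set.range ((↑) : ℚ → ℝ)] t) (𝓝 t) := by
      refine (tendsto_id.mono_left nhdsWithin_le_nhds).congr' ?_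
      filter_upwards [self_mem_nhdsWithin] with x hx
      exact (switch_of_not_irrational (fun h ↦ h hx)).symm
    haveI : (𝓝[Set.range ((↑) : ℚ → ℝ)] t).NeBot :=
      mem_closure_iff_nhdsWithin_neBot.1 (Rat.denseRange_cast (𝕜 := ℝ) t)
    have ht1 : switch t = t := tendsto_nhds_unique (hc.mono_left nhdsWithin_le_nhds) hq
    have hi : Tendsto switch (𝓝[{x | Irrational x}] t) (𝓝 0) := by
      refine tendsto_const_nhds.congr' ?_
      filter_upwards [self_mem_nhdsWithin] with x hx
      exact (switch_of_irrational hx).symm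
    haveI : (𝓝[{x : ℝ | Irrational x}] t).NeBot :=
      mem_closure_iff_nhdsWithin_neBot.1 (dense_irrational t)
    have ht0 : switch t = 0 := tendsto_nhds_unique (hc.mono_left nhdsWithin_le_nhds) hi
    exact ht (ht1.symm.trans ht0)

/-- The conformal factor `a(x, y) = exp (switch x)`: positive, differentiable nowhere, → 1 at 0. [folklore] -/
def factor (p : ℝ × ℝ) : ℝ := Real.exp (switch p.1)

/-- The conformal factor is positive. [folklore] -/
theorem factor_pos (p : ℝ × ℝ) : 0 < factor p := Real.exp_pos _

/-- The conformal factor is nonzero. [folklore] -/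
theorem factor_ne_zero (p : ℝ × ℝ) : factor p ≠ 0 := (factor_pos p).ne'

/-- The conformal factor is `1` at the origin. [folklore] -/
@[simp] theorem factor_zero : factor 0 = 1 := by simp [factor]

/-- The conformal factor is differentiable at no point of the plane (restrict to a horizontal
line and take logarithms). [folklore] -/
theorem not_differentiableAt_factor (p : ℝ × ℝ) : ¬ DifferentiableAt ℝ factor p := by
  obtain ⟨x, y⟩ := p
  intro hd
  have hf : DifferentiableAt ℝ (fun t : ℝ ↦ (t, y)) x :=
    differentiableAt_id.prodMk (differentiableAt_const y)
  have h1 : DifferentiableAt ℝ (factor ∘ fun t : ℝ ↦ (t, y)) x := hd.comp x hf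
  have h2 : DifferentiableAt ℝ (Real.log ∘ (factor ∘ fun t : ℝ ↦ (t, y))) x :=
    (Real.differentiableAt_log (factor_ne_zero _)).comp x h1
  have h3 : Real.log ∘ (factor ∘ fun t : ℝ ↦ (t, y)) = switch := by
    funext t
    simp [factor]
  rw [h3] at h2
  exact not_differentiableAt_switch x h2

/-- The conformal factor tends to `1` at the origin. [folklore] -/
theorem tendsto_factor_zero : Tendsto factor (𝓝 0) (𝓝 1) := by
  have h : Tendsto (fun p : ℝ × ℝ ↦ switch p.1) (𝓝 0) (𝓝 0) :=
    tendsto_switch_zero.comp (continuous_fst.tendsto' (0 : ℝ × ℝ) 0 rfl)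
  have h2 : factor = Real.exp ∘ fun p : ℝ × ℝ ↦ switch p.1 := rfl
  rw [h2]
  simpa using (Real.continuous_exp.tendsto 0).comp h

/-- The inverse conformal factor tends to `1` at the origin. [folklore] -/
theorem tendsto_factor_inv_zero : Tendsto (fun p ↦ (factor p)⁻¹) (𝓝 0) (𝓝 1) := by
  simpa using tendsto_factor_zero.inv₀ one_ne_zero

/-! ### The rough metric on `ℝ²` -/

/-- `finrank ℝ (ℝ × ℝ) = 2`, as the `Fact` consumed by `Orientation.volumeForm`. [folklore] -/
theorem fact_finrank_real_prod : Fact (finrank ℝ (ℝ × ℝ) = 2) := ⟨by simp⟩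

attribute [local instance] fact_finrank_real_prod

local notation "T" => TangentSpace 𝓘(ℝ, ℝ × ℝ)

/-- The metric `a dx² + a⁻¹ dy²` (`a = factor`) as a continuous bilinear form on `ℝ²`. [folklore] -/
def metricInner (p : ℝ × ℝ) : (ℝ × ℝ) →L[ℝ] (ℝ × ℝ) →L[ℝ] ℝ :=
  factor p • (ContinuousLinearMap.mul ℝ ℝ).bilinearComp
      (ContinuousLinearMap.fst ℝ ℝ ℝ) (ContinuousLinearMap.fst ℝ ℝ ℝ) +
    (factor p)⁻¹ • (ContinuousLinearMap.mul ℝ ℝ).bilinearComp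
      (ContinuousLinearMap.snd ℝ ℝ ℝ) (ContinuousLinearMap.snd ℝ ℝ ℝ)

/-- Unfolding of `metricInner`: `g(v, w) = a v₁ w₁ + a⁻¹ v₂ w₂`. [folklore] -/
@[simp]
theorem metricInner_apply (p : ℝ × ℝ) (v w : ℝ × ℝ) :
    metricInner p v w = factor p * (v.1 * w.1) + (factor p)⁻¹ * (v.2 * w.2) := by
  simp [metricInner]

set_option backward.isDefEq.respectTransparency false in
/-- The rough Riemannian metric `a dx² + a⁻¹ dy²` on the tangent spaces of `ℝ²` (Mathlib's
`Bundle.RiemannianMetric`: no regularity in the base point is required, and none holds). [folklore] -/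
def roughMetric : RiemannianMetric (fun x : ℝ × ℝ ↦ T x) where
  inner p := (metricInner p : (ℝ × ℝ) →L[ℝ] (ℝ × ℝ) →L[ℝ] ℝ)
  symm p v w := by
    change metricInner p v w = metricInner p w v
    rw [metricInner_apply, metricInner_apply]
    ring
  pos p v hv := by
    change 0 < metricInner p v v
    rw [metricInner_apply]
    have h1 := factor_pos p
    have h2 : 0 < (factor p)⁻¹ := inv_pos.2 h1
    obtain ⟨v1, v2⟩ := v
    have : v1 ≠ 0 ∨ v2 ≠ 0 := by
      by_contra h
      simp only [not_or, not_not] at h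
      exact hv (by rw [h.1, h.2]; rfl)
    rcases this with h | h
    · have := mul_pos h1 (mul_self_pos.2 h)
      nlinarith [mul_nonneg h2.le (mul_self_nonneg v2)]
    · have := mul_pos h2 (mul_self_pos.2 h)
      nlinarith [mul_nonneg h1.le (mul_self_nonneg v1)]
  continuousAt p := by
    change ContinuousAt (fun v : ℝ × ℝ ↦ metricInner p v v) 0
    exact ((metricInner p).continuous₂.comp (continuous_id.prodMk continuous_id)).continuousAt
  isVonNBounded p := by
    change Bornology.IsVonNBounded ℝ {v : ℝ × ℝ | metricInner p v v < 1}
    have h1 := factor_pos p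
    have h2 : 0 < (factor p)⁻¹ := inv_pos.2 h1
    refine (NormedSpace.isVonNBounded_closedBall ℝ (ℝ × ℝ)
      ((factor p)⁻¹ + factor p)).subset ?_
    intro v hv
    simp only [mem_setOf_eq, metricInner_apply] at hv
    simp only [Metric.mem_closedBall, dist_zero_right, Prod.norm_def, Real.norm_eq_abs, max_le_iff]
    have hv1 : factor p * (v.1 * v.1) < 1 := by
      nlinarith [mul_nonneg h2.le (mul_self_nonneg v.2)]
    have hv2 : (factor p)⁻¹ * (v.2 * v.2) < 1 := by
      nlinarith [mul_nonneg h1.le (mul_self_nonneg v.1)]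
    constructor
    · nlinarith [abs_nonneg v.1, abs_mul_abs_self v.1, sq_nonneg (|v.1| - 1),
        mul_inv_cancel₀ h1.ne', sq_abs v.1]
    · nlinarith [abs_nonneg v.2, abs_mul_abs_self v.2, sq_nonneg (|v.2| - 1),
        mul_inv_cancel₀ h1.ne', sq_abs v.2]

/-- The rough Riemannian bundle structure on the tangent spaces of `ℝ²` (a `def`, used as a
*local* instance in this file only). [folklore] -/
@[reducible] def roughBundle : RiemannianBundle (fun x : ℝ × ℝ ↦ T x) := ⟨roughMetric⟩

attribute [local instance] roughBundle

/-- The inner product of the local Riemannian structure is `metricInner` (by construction). [folklore] -/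
theorem inner_eq (p : ℝ × ℝ) (v w : T p) : inner ℝ v w = metricInner p v w := rfl

/-- The coordinate vector `∂ₓ = (1, 0)` in the tangent space at `p`. [folklore] -/
def e₀ (p : ℝ × ℝ) : T p := ((1, 0) : ℝ × ℝ)

/-- The coordinate vector `∂_y = (0, 1)` in the tangent space at `p`. [folklore] -/
def e₁ (p : ℝ × ℝ) : T p := ((0, 1) : ℝ × ℝ)

/-- Coordinates of `∂ₓ`. [folklore] -/
@[simp] theorem fst_e₀ (p : ℝ × ℝ) : Prod.fst (e₀ p) = 1 := rfl
/-- Coordinates of `∂ₓ`. [folklore] -/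
@[simp] theorem snd_e₀ (p : ℝ × ℝ) : Prod.snd (e₀ p) = 0 := rfl
/-- Coordinates of `∂_y`. [folklore] -/
@[simp] theorem fst_e₁ (p : ℝ × ℝ) : Prod.fst (e₁ p) = 0 := rfl
/-- Coordinates of `∂_y`. [folklore] -/
@[simp] theorem snd_e₁ (p : ℝ × ℝ) : Prod.snd (e₁ p) = 1 := rfl

/-- Coordinate decomposition of a tangent vector. [folklore] -/
theorem eq_smul_e₀_add_smul_e₁ (p : ℝ × ℝ) (v : T p) :
    v = Prod.fst v • e₀ p + Prod.snd v • e₁ p := by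
  refine Prod.ext ?_ ?_
  · change Prod.fst v = Prod.fst v * 1 + Prod.snd v * 0
    simp
  · change Prod.snd v = Prod.fst v * 0 + Prod.snd v * 1
    simp

/-- The standard basis `(∂ₓ, ∂_y)` of the tangent space at `p` (Mathlib's `Basis.finTwoProd`). [folklore] -/
def stdBasis (p : ℝ × ℝ) : Module.Basis (Fin 2) ℝ (T p) := Module.Basis.finTwoProd ℝ

/-- The standard basis is `(∂ₓ, ∂_y)`. [folklore] -/
theorem stdBasis_apply (p : ℝ × ℝ) : ⇑(stdBasis p) = ![e₀ p, e₁ p] := by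
  funext i
  fin_cases i
  · exact Module.Basis.finTwoProd_zero ℝ
  · exact Module.Basis.finTwoProd_one ℝ

/-- The standard orientation of `ℝ²`, on every tangent space. [folklore] -/
def stdOrientation : (x : ℝ × ℝ) → Orientation ℝ (T x) (Fin 2) :=
  fun p ↦ (stdBasis p).orientation

/-- The `g`-orthonormal frame `(a^{-1/2} ∂ₓ, a^{1/2} ∂_y)`. [folklore] -/
def frame (p : ℝ × ℝ) : Fin 2 → T p :=
  ![((Real.exp (-(switch p.1 / 2)), 0) : ℝ × ℝ), ((0, Real.exp (switch p.1 / 2)) : ℝ × ℝ)]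

/-- `a · e^{-s/2} · e^{-s/2} = 1` (`a = e^s`). [folklore] -/
theorem factor_mul_exp_mul_exp (p : ℝ × ℝ) :
    factor p * (Real.exp (-(switch p.1 / 2)) * Real.exp (-(switch p.1 / 2))) = 1 := by
  rw [factor, ← Real.exp_add, ← Real.exp_add]
  ring_nf
  exact Real.exp_zero

/-- `a⁻¹ · e^{s/2} · e^{s/2} = 1` (`a = e^s`). [folklore] -/
theorem factor_inv_mul_exp_mul_exp (p : ℝ × ℝ) :
    (factor p)⁻¹ * (Real.exp (switch p.1 / 2) * Real.exp (switch p.1 / 2)) = 1 := by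
  rw [factor, ← Real.exp_neg, ← Real.exp_add, ← Real.exp_add]
  ring_nf
  exact Real.exp_zero

/-- `(a e^{-s/2}) (a⁻¹ e^{s/2}) = 1` (`a = e^s`). [folklore] -/
theorem factor_mul_exp_mul_factor_inv_mul_exp (p : ℝ × ℝ) :
    factor p * Real.exp (-(switch p.1 / 2)) * ((factor p)⁻¹ * Real.exp (switch p.1 / 2)) = 1 := by
  rw [mul_mul_mul_comm, mul_inv_cancel₀ (factor_ne_zero p), ← Real.exp_add]
  simp

/-- The frame `(a^{-1/2} ∂ₓ, a^{1/2} ∂_y)` is `g`-orthonormal. [folklore] -/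
theorem orthonormal_frame (p : ℝ × ℝ) : Orthonormal ℝ (frame p) := by
  rw [orthonormal_iff_ite]
  intro i j
  fin_cases i <;> fin_cases j
  · rw [inner_eq, metricInner_apply]
    simpa [frame] using factor_mul_exp_mul_exp p
  · rw [inner_eq, metricInner_apply]
    simp [frame]
  · rw [inner_eq, metricInner_apply]
    simp [frame]
  · rw [inner_eq, metricInner_apply]
    simpa [frame] using factor_inv_mul_exp_mul_exp p

/-- The tangent spaces of the plane are `2`-dimensional. [folklore] -/
theorem finrank_tangentSpace (p : ℝ × ℝ) : finrank ℝ (T p) = 2 := finrank_prod.trans (by simp)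

/-- The frame as an orthonormal basis of the tangent space at `p`. [folklore] -/
def onb (p : ℝ × ℝ) : OrthonormalBasis (Fin 2) ℝ (T p) :=
  (basisOfOrthonormalOfCardEqFinrank (orthonormal_frame p)
    (by rw [finrank_tangentSpace]; simp)).toOrthonormalBasis
    (by simpa using orthonormal_frame p)

/-- The orthonormal basis is the frame. [folklore] -/
@[simp]
theorem onb_apply (p : ℝ × ℝ) : ⇑(onb p) = frame p := by
  simp [onb]

/-- `g(a^{-1/2} ∂ₓ, v) = a · a^{-1/2} · v₁`. [folklore] -/
theorem inner_frame_zero (p : ℝ × ℝ) (v : T p) :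
    inner ℝ (frame p 0) v = factor p * Real.exp (-(switch p.1 / 2)) * Prod.fst v := by
  rw [inner_eq, metricInner_apply]
  simp [frame]
  ring

/-- `g(a^{1/2} ∂_y, v) = a⁻¹ · a^{1/2} · v₂`. [folklore] -/
theorem inner_frame_one (p : ℝ × ℝ) (v : T p) :
    inner ℝ (frame p 1) v = (factor p)⁻¹ * Real.exp (switch p.1 / 2) * Prod.snd v := by
  rw [inner_eq, metricInner_apply]
  simp [frame]
  ring

/-- The determinant of the orthonormal frame is the standard determinant `v₁ w₂ - v₂ w₁`
(the frame is obtained from `(∂ₓ, ∂_y)` by a diagonal matrix of determinant `1`). [folklore] -/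
theorem det_onb (p : ℝ × ℝ) (v w : T p) :
    (onb p).toBasis.det ![v, w] = Prod.fst v * Prod.snd w - Prod.snd v * Prod.fst w := by
  rw [Basis.det_apply, Matrix.det_fin_two]
  simp only [Basis.toMatrix_apply, OrthonormalBasis.coe_toBasis_repr_apply,
    OrthonormalBasis.repr_apply_apply, onb_apply, inner_frame_zero, inner_frame_one]
  simp
  linear_combination (Prod.fst v * Prod.snd w - Prod.snd v * Prod.fst w) *
    factor_mul_exp_mul_factor_inv_mul_exp p

/-- The frame is positively oriented for the standard orientation. [folklore] -/
theorem orientation_onb (p : ℝ × ℝ) : (onb p).toBasis.orientation = stdOrientation p := by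
  rw [stdOrientation, Basis.orientation_eq_iff_det_pos, stdBasis_apply, det_onb]
  simp

/-- The Riemannian volume form of the rough metric is the standard determinant at every point. [folklore] -/
theorem volumeForm_apply (p : ℝ × ℝ) (v w : T p) :
    (stdOrientation p).volumeForm ![v, w] = Prod.fst v * Prod.snd w - Prod.snd v * Prod.fst w := by
  rw [Orientation.volumeForm_robust (stdOrientation p) (onb p) (orientation_onb p), det_onb]

/-! ### The Hodge star of the rough metric on `1`-forms and `2`-forms -/

/-- The Riesz representative of a covector `ℓ` for the rough metric: `(ℓ(∂ₓ)/a, a ℓ(∂_y))`. [folklore] -/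
def riesz (p : ℝ × ℝ) (ℓ : T p →L[ℝ] ℝ) : T p :=
  (((factor p)⁻¹ * ℓ (e₀ p), factor p * ℓ (e₁ p)) : ℝ × ℝ)

/-- `riesz p ℓ` represents `ℓ`: `g(riesz ℓ, ·) = ℓ`. [folklore] -/
theorem innerSL_riesz (p : ℝ × ℝ) (ℓ : T p →L[ℝ] ℝ) : innerSL ℝ (riesz p ℓ) = ℓ := by
  ext v
  rw [innerSL_apply_apply, inner_eq, metricInner_apply]
  conv_rhs => rw [eq_smul_e₀_add_smul_e₁ p v]
  simp only [riesz, map_add, map_smul, smul_eq_mul]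
  field_simp [factor_ne_zero p]

/-- The Hodge star of the rough metric on `1`-forms: `⋆(β₀ dx + β₁ dy) = (β₀ / a) dy - a β₁ dx`. [folklore] -/
theorem hodgeStar_ofSubsingleton_apply (p : ℝ × ℝ) (h : 1 + 1 = 2) (ℓ : T p →L[ℝ] ℝ) (w : T p) :
    hodgeStar (stdOrientation p) h (ContinuousAlternatingMap.ofSubsingleton ℝ (T p) ℝ (0 : Fin 1) ℓ)
        ![w] =
      (factor p)⁻¹ * ℓ (e₀ p) * Prod.snd w - factor p * ℓ (e₁ p) * Prod.fst w := by
  rw [← innerSL_riesz p ℓ, hodgeStar_apply_eq_areaForm_holds (stdOrientation p) h,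
    Orientation.areaForm_to_volumeForm, volumeForm_apply, innerSL_riesz]
  simp [riesz]

/-! ### Forms on the flat plane -/

/-- In the flat case the chart representative of a form is the form itself. [folklore] -/
theorem inChart_eq_self {F : Type*} [NormedAddCommGroup F] [NormedSpace ℝ F] {k : ℕ}
    (α : MForm 𝓘(ℝ, ℝ × ℝ) (ℝ × ℝ) F k) (x : ℝ × ℝ) : α.inChart x = α := by
  funext y
  ext v
  simp [MForm.inChart_apply]
  rfl

/-- A form on the flat plane as a plain map into the fixed model fibre (the identity, retyped:
`TangentSpace 𝓘(ℝ, ℝ × ℝ) x` is `ℝ × ℝ` by definition). [folklore] -/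
def flat {k : ℕ} (α : MForm 𝓘(ℝ, ℝ × ℝ) (ℝ × ℝ) ℝ k) : (ℝ × ℝ) → (ℝ × ℝ) [⋀^Fin k]→L[ℝ] ℝ := α

/-- In the flat case, chart-wise smoothness is plain smoothness. [folklore] -/
theorem isSmoothForm_of_contDiff {k : ℕ} {α : MForm 𝓘(ℝ, ℝ × ℝ) (ℝ × ℝ) ℝ k}
    (hα : ContDiff ℝ ∞ (flat α)) : IsSmoothForm α := by
  intro x
  rw [inChart_eq_self]
  exact hα.contDiffAt.contDiffWithinAt

/-- In the flat case, a chart-wise smooth form is differentiable as a plain map. [folklore] -/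
theorem differentiableAt_of_isSmoothForm {k : ℕ} {β : MForm 𝓘(ℝ, ℝ × ℝ) (ℝ × ℝ) ℝ k}
    (hβ : IsSmoothForm β) (p : ℝ × ℝ) : DifferentiableAt ℝ (flat β) p := by
  have h := hβ p
  rw [inChart_eq_self] at h
  simp only [modelWithCornersSelf_coe, Set.range_id, extChartAt_self_apply, id_eq,
    contDiffWithinAt_univ] at h
  exact h.differentiableAt (by simp)

/-- The `0`-form attached to a function. [folklore] -/
def zeroForm (f : ℝ × ℝ → ℝ) : MForm 𝓘(ℝ, ℝ × ℝ) (ℝ × ℝ) ℝ 0 :=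
  fun x ↦ ContinuousAlternatingMap.constOfIsEmpty ℝ (T x) (Fin 0) (f x)

/-- `zeroForm` is additive. [folklore] -/
theorem zeroForm_add (f g : ℝ × ℝ → ℝ) : zeroForm (f + g) = zeroForm f + zeroForm g := by
  funext x
  ext v
  simp [zeroForm]

/-- The `0`-form of a smooth function is a smooth form. [folklore] -/
theorem isSmoothForm_zeroForm {f : ℝ × ℝ → ℝ} (hf : ContDiff ℝ ∞ f) : IsSmoothForm (zeroForm f) :=
  isSmoothForm_of_contDiff
    ((ContinuousAlternatingMap.constOfIsEmptyLIE ℝ (ℝ × ℝ) ℝ (Fin 0)).contDiff.comp hf)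

/-- The `1`-form attached to a family of covectors. [folklore] -/
def oneForm (ℓ : (ℝ × ℝ) → (ℝ × ℝ) →L[ℝ] ℝ) : MForm 𝓘(ℝ, ℝ × ℝ) (ℝ × ℝ) ℝ 1 :=
  fun x ↦ ContinuousAlternatingMap.ofSubsingleton ℝ (T x) ℝ (0 : Fin 1) (ℓ x)

/-- `d` of the `0`-form of `f` is the `1`-form of `fderiv ℝ f` (Mathlib's
`extDeriv_constOfIsEmpty`, through `mextDeriv_eq_extDeriv`). [folklore] -/
theorem mextDeriv_zeroForm (f : ℝ × ℝ → ℝ) : mextDeriv (zeroForm f) = oneForm (fderiv ℝ f) := by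
  funext x
  rw [mextDeriv_eq_extDeriv]
  exact extDeriv_constOfIsEmpty f x

/-- `dx` as a constant `1`-form (in the fixed model space). [folklore] -/
def DX : (ℝ × ℝ) [⋀^Fin 1]→L[ℝ] ℝ :=
  ContinuousAlternatingMap.ofSubsingleton ℝ (ℝ × ℝ) ℝ (0 : Fin 1) (ContinuousLinearMap.fst ℝ ℝ ℝ)

/-- `dy` as a constant `1`-form (in the fixed model space). [folklore] -/
def DY : (ℝ × ℝ) [⋀^Fin 1]→L[ℝ] ℝ :=
  ContinuousAlternatingMap.ofSubsingleton ℝ (ℝ × ℝ) ℝ (0 : Fin 1) (ContinuousLinearMap.snd ℝ ℝ ℝ)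

/-- `dx (v) = v₁`. [folklore] -/
@[simp] theorem DX_apply (v : Fin 1 → ℝ × ℝ) : DX v = (v 0).1 := rfl
/-- `dy (v) = v₂`. [folklore] -/
@[simp] theorem DY_apply (v : Fin 1 → ℝ × ℝ) : DY v = (v 0).2 := rfl

/-- The Hodge star of the rough metric on the `1`-form attached to `ℓ`, as an explicit form:
`⋆(ℓ₀ dx + ℓ₁ dy) = (ℓ₀ / a) dy - a ℓ₁ dx`. [folklore] -/
theorem hodgeStar_oneForm (h : 1 + 1 = 2) (ℓ : (ℝ × ℝ) → (ℝ × ℝ) →L[ℝ] ℝ) :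
    MForm.hodgeStar stdOrientation h (oneForm ℓ) = fun p ↦
      (((factor p)⁻¹ * ℓ p (1, 0)) • DY - (factor p * ℓ p (0, 1)) • DX :
        (ℝ × ℝ) [⋀^Fin 1]→L[ℝ] ℝ) := by
  funext p
  ext w
  have hw : w = ![w 0] := by
    funext i
    fin_cases i
    rfl
  rw [MForm.hodgeStar_apply, hw, oneForm, hodgeStar_ofSubsingleton_apply]
  change _ = (factor p)⁻¹ * ℓ p (1, 0) * Prod.snd (w 0) - factor p * ℓ p (0, 1) * Prod.fst (w 0)
  rfl


/-- A form-valued map whose `dx`-coefficient along `∂ₓ` is a nonzero multiple of the conformal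
factor is differentiable nowhere. [folklore] -/
theorem not_differentiableAt_of_apply_eq {S : (ℝ × ℝ) → (ℝ × ℝ) [⋀^Fin 1]→L[ℝ] ℝ} {c : ℝ}
    (hc : c ≠ 0) (hS : ∀ q, S q ![((1 : ℝ), (0 : ℝ))] = c * factor q) (p : ℝ × ℝ) :
    ¬ DifferentiableAt ℝ S p := by
  intro hd
  have h1 : DifferentiableAt ℝ
      (⇑(ContinuousAlternatingMap.apply ℝ (ℝ × ℝ) ℝ ![((1 : ℝ), (0 : ℝ))]) ∘ S) p :=
    (ContinuousLinearMap.differentiableAt _).comp p hd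
  have h2 : ⇑(ContinuousAlternatingMap.apply ℝ (ℝ × ℝ) ℝ ![((1 : ℝ), (0 : ℝ))]) ∘ S =
      fun q ↦ c * factor q := by
    funext q
    exact hS q
  rw [h2] at h1
  have h3 : DifferentiableAt ℝ (fun q ↦ c⁻¹ * (c * factor q)) p := h1.const_mul c⁻¹
  simp only [inv_mul_cancel_left₀ hc] at h3
  exact not_differentiableAt_factor p h3

/-- Junk values: the manifold exterior derivative of a nowhere-differentiable `1`-form-valued map
vanishes identically (`fderiv` is `0` at points of non-differentiability). [folklore] -/
theorem mextDeriv_eq_zero_of_forall_not_differentiableAt {β : MForm 𝓘(ℝ, ℝ × ℝ) (ℝ × ℝ) ℝ 1}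
    (hβ : ∀ p, ¬ DifferentiableAt ℝ (flat β) p) : mextDeriv β = 0 := by
  funext p
  rw [mextDeriv_eq_extDeriv, Pi.zero_apply]
  change ContinuousAlternatingMap.alternatizeUncurryFin (fderiv ℝ (flat β) p) = 0
  rw [fderiv_zero_of_not_differentiableAt (hβ p)]
  exact map_zero _

/-! ### The three functions -/

/-- `f₁ (x, y) = y + x² / 2`. [folklore] -/
def f₁ (p : ℝ × ℝ) : ℝ := p.2 + p.1 ^ 2 / 2

/-- `f₂ (x, y) = -y`. [folklore] -/
def f₂ (p : ℝ × ℝ) : ℝ := -p.2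

/-- `u (x, y) = x² / 2 = f₁ + f₂`. [folklore] -/
def u (p : ℝ × ℝ) : ℝ := p.1 ^ 2 / 2

/-- `f₁ + f₂ = u`. [folklore] -/
theorem f₁_add_f₂ : f₁ + f₂ = u := by
  funext p
  simp [f₁, f₂, u]

/-- `u` is smooth. [folklore] -/
theorem contDiff_u : ContDiff ℝ ∞ u := (contDiff_fst.pow 2).div_const 2

/-- `f₁` is smooth. [folklore] -/
theorem contDiff_f₁ : ContDiff ℝ ∞ f₁ := contDiff_snd.add contDiff_u

/-- `f₂` is smooth. [folklore] -/
theorem contDiff_f₂ : ContDiff ℝ ∞ f₂ := contDiff_snd.neg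

/-- `Du (x, y) = x dx`. [folklore] -/
theorem hasFDerivAt_u (p : ℝ × ℝ) : HasFDerivAt u (p.1 • ContinuousLinearMap.fst ℝ ℝ ℝ) p := by
  have h : HasDerivAt (fun t : ℝ ↦ t ^ 2 / 2) (((2 : ℕ) : ℝ) * p.1 ^ (2 - 1) / 2) p.1 :=
    (hasDerivAt_pow 2 p.1).div_const 2
  have h2 : ((2 : ℕ) : ℝ) * p.1 ^ (2 - 1) / 2 = p.1 := by norm_num
  rw [h2] at h
  exact h.comp_hasFDerivAt p hasFDerivAt_fst

/-- `Du = x dx`. [folklore] -/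
theorem fderiv_u : fderiv ℝ u = fun p ↦ p.1 • ContinuousLinearMap.fst ℝ ℝ ℝ :=
  funext fun p ↦ (hasFDerivAt_u p).fderiv

/-- `Df₁ = dy + x dx`. [folklore] -/
theorem fderiv_f₁ :
    fderiv ℝ f₁ = fun p ↦ ContinuousLinearMap.snd ℝ ℝ ℝ + p.1 • ContinuousLinearMap.fst ℝ ℝ ℝ :=
  funext fun p ↦ (hasFDerivAt_snd.add (hasFDerivAt_u p)).fderiv

/-- `Df₂ = -dy`. [folklore] -/
theorem fderiv_f₂ : fderiv ℝ f₂ = fun _ ↦ -ContinuousLinearMap.snd ℝ ℝ ℝ :=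
  funext fun _ ↦ hasFDerivAt_snd.neg.fderiv

/-! ### `⋆ d` of the three functions -/

/-- `⋆ d f₁ = (x / a) dy - a dx`. [folklore] -/
theorem hodgeStar_mextDeriv_f₁ (h : 0 + 1 + 1 = 2) :
    MForm.hodgeStar stdOrientation h (mextDeriv (zeroForm f₁)) = fun p ↦
      (((factor p)⁻¹ * p.1) • DY - factor p • DX : (ℝ × ℝ) [⋀^Fin 1]→L[ℝ] ℝ) := by
  rw [mextDeriv_zeroForm, fderiv_f₁]
  refine (hodgeStar_oneForm h _).trans ?_
  funext p
  simp

/-- `⋆ d f₂ = a dx`. [folklore] -/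
theorem hodgeStar_mextDeriv_f₂ (h : 0 + 1 + 1 = 2) :
    MForm.hodgeStar stdOrientation h (mextDeriv (zeroForm f₂)) = fun p ↦
      (factor p • DX : (ℝ × ℝ) [⋀^Fin 1]→L[ℝ] ℝ) := by
  rw [mextDeriv_zeroForm, fderiv_f₂]
  refine (hodgeStar_oneForm h _).trans ?_
  funext p
  simp only [_root_.neg_apply, ContinuousLinearMap.coe_snd', mul_neg, mul_zero,
    neg_zero, zero_smul, mul_one, zero_sub]
  module

/-- `⋆ d u = (x / a) dy`. [folklore] -/
theorem hodgeStar_mextDeriv_u (h : 0 + 1 + 1 = 2) :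
    MForm.hodgeStar stdOrientation h (mextDeriv (zeroForm u)) = fun p ↦
      (((factor p)⁻¹ * p.1) • DY : (ℝ × ℝ) [⋀^Fin 1]→L[ℝ] ℝ) := by
  rw [mextDeriv_zeroForm, fderiv_u]
  refine (hodgeStar_oneForm h _).trans ?_
  funext p
  simp

/-- `⋆ d f₁` is differentiable nowhere (its `dx`-coefficient is `-a`). [folklore] -/
theorem not_differentiableAt_hodgeStar_mextDeriv_f₁ (h : 0 + 1 + 1 = 2) (p : ℝ × ℝ) :
    ¬ DifferentiableAt ℝ (flat (MForm.hodgeStar stdOrientation h (mextDeriv (zeroForm f₁)))) p := by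
  rw [hodgeStar_mextDeriv_f₁]
  unfold flat
  refine not_differentiableAt_of_apply_eq (c := -1) (by norm_num) (fun q ↦ ?_) p
  simp

/-- `⋆ d f₂` is differentiable nowhere (its `dx`-coefficient is `a`). [folklore] -/
theorem not_differentiableAt_hodgeStar_mextDeriv_f₂ (h : 0 + 1 + 1 = 2) (p : ℝ × ℝ) :
    ¬ DifferentiableAt ℝ (flat (MForm.hodgeStar stdOrientation h (mextDeriv (zeroForm f₂)))) p := by
  rw [hodgeStar_mextDeriv_f₂]
  unfold flat
  refine not_differentiableAt_of_apply_eq (c := 1) (by norm_num) (fun q ↦ ?_) p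
  simp

/-- The coefficient `x / a` of `⋆ d u` is differentiable at the origin, with derivative `dx`
(because `1 / a → 1` there). [folklore] -/
theorem hasFDerivAt_factor_inv_mul_fst :
    HasFDerivAt (fun p : ℝ × ℝ ↦ (factor p)⁻¹ * p.1) (ContinuousLinearMap.fst ℝ ℝ ℝ) 0 := by
  rw [hasFDerivAt_iff_isLittleO_nhds_zero]
  have hg : (fun p : ℝ × ℝ ↦ (factor p)⁻¹ - 1) =o[𝓝 0] (fun _ ↦ (1 : ℝ)) := by
    rw [Asymptotics.isLittleO_one_iff]
    simpa using tendsto_factor_inv_zero.sub_const 1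
  have hk : (fun p : ℝ × ℝ ↦ p.1) =O[𝓝 (0 : ℝ × ℝ)] (fun p ↦ p) :=
    Asymptotics.IsBigO.of_bound 1 (Eventually.of_forall fun p ↦ by simpa using norm_fst_le p)
  have key : (fun p : ℝ × ℝ ↦ ((factor p)⁻¹ - 1) * p.1) =o[𝓝 (0 : ℝ × ℝ)] (fun p ↦ p) :=
    ((hg.mul_isBigO hk.norm_right).congr_right (fun p ↦ one_mul _)).of_norm_right
  refine key.congr' (Eventually.of_forall fun p ↦ ?_) EventuallyEq.rfl
  simp only [zero_add, factor_zero, Prod.fst_zero, ContinuousLinearMap.coe_fst']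
  ring

/-! ### The `2`-form `dx ∧ dy` -/

/-- `dx ∧ dy` (in the fixed model space), written in the form in which it arises below as
`d ⋆ d u (0)`: the alternatisation of `h ↦ h₁ • dy`. [folklore] -/
def Ω : (ℝ × ℝ) [⋀^Fin (1 + 1)]→L[ℝ] ℝ :=
  ContinuousAlternatingMap.alternatizeUncurryFin ((ContinuousLinearMap.fst ℝ ℝ ℝ).smulRight DY)

/-- `Ω = dx ∧ dy`: `Ω (v, w) = v₁ w₂ - v₂ w₁`. [folklore] -/
theorem Ω_apply (v : Fin 2 → ℝ × ℝ) : Ω v = (v 0).1 * (v 1).2 - (v 0).2 * (v 1).1 := by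
  simp [Ω, ContinuousAlternatingMap.alternatizeUncurryFin_apply, Fin.sum_univ_two, Fin.removeNth]
  ring

/-- `dx ∧ dy ≠ 0`. [folklore] -/
theorem Ω_ne_zero : Ω ≠ 0 := fun h ↦ by
  simpa [h] using Ω_apply ![((1 : ℝ), (0 : ℝ)), ((0 : ℝ), (1 : ℝ))]

/-! ### The volume form is the constant `dx ∧ dy`, hence smooth -/

/-- The Riemannian volume form of the rough metric is the standard determinant (tuple form). [folklore] -/
theorem volumeForm_apply' (p : ℝ × ℝ) (v : Fin 2 → T p) :
    (stdOrientation p).volumeForm v =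
      Prod.fst (v 0) * Prod.snd (v 1) - Prod.snd (v 0) * Prod.fst (v 1) := by
  have hv : v = ![v 0, v 1] := by
    funext i
    fin_cases i <;> rfl
  rw [hv, volumeForm_apply]
  rfl

set_option backward.isDefEq.respectTransparency false in
/-- The Riemannian volume form of the rough metric is `dx ∧ dy` at every point. [folklore] -/
theorem volumeFormL_eq_Ω (p : ℝ × ℝ) :
    (stdOrientation p).volumeFormL = Ω := by
  refine ContinuousAlternatingMap.ext fun v ↦ ?_
  rw [Orientation.volumeFormL_apply, volumeForm_apply' p v]
  refine Eq.trans ?_ (Ω_apply v).symm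
  rfl

set_option backward.isDefEq.respectTransparency false in
/-- The Riemannian volume form of the rough metric is the constant form `dx ∧ dy`. [folklore] -/
theorem riemannianVolumeForm_eq : riemannianVolumeForm stdOrientation = fun _ ↦ Ω :=
  funext fun p ↦ volumeFormL_eq_Ω p

set_option backward.isDefEq.respectTransparency false in
/-- The hypothesis `ho` of the facts holds: the Riemannian volume form of the rough metric is
smooth (it is the constant form `dx ∧ dy`). [folklore] -/
theorem isSmoothForm_riemannianVolumeForm : IsSmoothForm (riemannianVolumeForm stdOrientation) := by
  rw [riemannianVolumeForm_eq]
  exact isSmoothForm_of_contDiff contDiff_const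

set_option backward.isDefEq.respectTransparency false in
/-- `⋆ (dx ∧ dy) ≠ 0` at the origin (indeed `⋆⋆ = 1` on `2`-forms and `dx ∧ dy ≠ 0`). [folklore] -/
theorem hodgeStar_Ω_ne_zero (h : 1 + 1 + 0 = 2) :
    hodgeStar (stdOrientation 0) h Ω ≠ 0 := by
  intro h0
  have key := hodgeStar_hodgeStar_holds (stdOrientation 0) h (show 0 + (1 + 1) = 2 by norm_num)
    Ω
  have h1 := congrArg (hodgeStar (stdOrientation 0) (show 0 + (1 + 1) = 2 by norm_num)) h0
  rw [key, map_zero] at h1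
  simp at h1
  exact Ω_ne_zero h1

/-! ### The Laplacians of the three functions -/

/-- Junk harmonicity: if `⋆ d f` is differentiable nowhere then `Δ f = -⋆ d ⋆ d f = 0`. [folklore] -/
theorem hodgeLaplacian_zeroForm_eq_zero {f : ℝ × ℝ → ℝ} (h : 0 + 2 = 2)
    (hf : ∀ (h' : 0 + 1 + 1 = 2) (p : ℝ × ℝ),
      ¬ DifferentiableAt ℝ (flat (MForm.hodgeStar stdOrientation h' (mextDeriv (zeroForm f)))) p) :
    hodgeLaplacian stdOrientation 0 2 h (zeroForm f) = 0 := by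
  simp only [hodgeLaplacian, mcoderiv]
  rw [mextDeriv_eq_zero_of_forall_not_differentiableAt (hf _), map_zero, smul_zero]

/-- `f₁ = y + x²/2` is harmonic for the rough metric (smooth, and `Δ f₁ = 0` by junk values). [folklore] -/
theorem isHarmonicForm_zeroForm_f₁ (h : 0 + 2 = 2) : IsHarmonicForm stdOrientation h (zeroForm f₁) :=
  ⟨isSmoothForm_zeroForm contDiff_f₁,
    hodgeLaplacian_zeroForm_eq_zero h not_differentiableAt_hodgeStar_mextDeriv_f₁⟩

/-- `f₂ = -y` is harmonic for the rough metric (smooth, and `Δ f₂ = 0` by junk values). [folklore] -/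
theorem isHarmonicForm_zeroForm_f₂ (h : 0 + 2 = 2) : IsHarmonicForm stdOrientation h (zeroForm f₂) :=
  ⟨isSmoothForm_zeroForm contDiff_f₂,
    hodgeLaplacian_zeroForm_eq_zero h not_differentiableAt_hodgeStar_mextDeriv_f₂⟩

/-- `x² / 2 = f₁ + f₂` lies in the span of the harmonic forms. [folklore] -/
theorem zeroForm_u_mem_harmonicForms (h : 0 + 2 = 2) :
    zeroForm u ∈ harmonicForms stdOrientation h := by
  rw [← f₁_add_f₂, zeroForm_add]
  exact add_mem (subset_harmonicForms _ h (isHarmonicForm_zeroForm_f₁ h))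
    (subset_harmonicForms _ h (isHarmonicForm_zeroForm_f₂ h))

set_option backward.isDefEq.respectTransparency false in
/-- `Δ (x² / 2) ≠ 0` at the origin: `⋆ d u = (x / a) dy` is differentiable there with
`d ⋆ d u (0) = dx ∧ dy`, and `⋆ (dx ∧ dy) ≠ 0`. [folklore] -/
theorem hodgeLaplacian_zeroForm_u_apply_zero_ne (h : 0 + 2 = 2) :
    hodgeLaplacian stdOrientation 0 2 h (zeroForm u) 0 ≠ 0 := by
  simp only [hodgeLaplacian, mcoderiv]
  rw [Pi.smul_apply, MForm.hodgeStar_apply, smul_ne_zero_iff]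
  refine ⟨by norm_num, ?_⟩
  rw [hodgeStar_mextDeriv_u, mextDeriv_eq_extDeriv, extDeriv,
    (hasFDerivAt_factor_inv_mul_fst.smul_const DY).fderiv]
  exact hodgeStar_Ω_ne_zero _

/-- `u = x²/2` is not harmonic for the rough metric. [folklore] -/
theorem not_isHarmonicForm_zeroForm_u (h : 0 + 2 = 2) :
    ¬ IsHarmonicForm stdOrientation h (zeroForm u) := fun hu ↦
  hodgeLaplacian_zeroForm_u_apply_zero_ne h (by rw [hu.2]; rfl)

/-! ### Conclusions -/

/-- **The rough metric violates `mem_harmonicForms_iff`** (degree `0`, dimension `2`): the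
smooth function `x² / 2` lies in `harmonicForms` (it is the sum of the harmonic `y + x² / 2` and
`-y`) but is not harmonic. [folklore] -/
theorem not_mem_harmonicForms_iff :
    ¬ mem_harmonicForms_iff (k := 0) (m := 2) stdOrientation := fun H ↦
  not_isHarmonicForm_zeroForm_u _ ((H isSmoothForm_riemannianVolumeForm (by norm_num) _).1
    (zeroForm_u_mem_harmonicForms _))

/-- **The rough metric violates `isSmoothForm_hodgeStar`** (degree `1`, dimension `2`): `dy` is
smooth but `⋆ dy = -a dx` is differentiable nowhere. [folklore] -/
theorem not_isSmoothForm_hodgeStar :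
    ¬ isSmoothForm_hodgeStar (k := 1) (m := 1) stdOrientation := by
  intro H
  have hα : IsSmoothForm (oneForm fun _ ↦ ContinuousLinearMap.snd ℝ ℝ ℝ) := by
    refine isSmoothForm_of_contDiff ?_
    have : flat (oneForm fun _ ↦ ContinuousLinearMap.snd ℝ ℝ ℝ) = fun _ ↦ DY := rfl
    rw [this]
    exact contDiff_const
  have hd := differentiableAt_of_isSmoothForm
    (H isSmoothForm_riemannianVolumeForm (by norm_num : 1 + 1 = 2) hα) 0
  rw [hodgeStar_oneForm] at hd
  unfold flat at hd
  refine not_differentiableAt_of_apply_eq (c := -1) (by norm_num) (fun q ↦ ?_) 0 hd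
  simp

end RoughMetric

attribute [local instance] RoughMetric.fact_finrank_real_prod RoughMetric.roughBundle

/-- **`mem_harmonicForms_iff` cannot be discharged as stated**: its universal closure over
Riemannian bundle metrics of no regularity is false (witness: `RoughMetric.roughBundle` on
`ℝ²` with the standard orientation, `RoughMetric.not_mem_harmonicForms_iff`). [folklore] -/
theorem not_forall_mem_harmonicForms_iff :
    ¬ ∀ (M : Type) [TopologicalSpace M] [ChartedSpace (ℝ × ℝ) M]
        [RiemannianBundle (fun x : M ↦ TangentSpace 𝓘(ℝ, ℝ × ℝ) x)]
        (o : (x : M) → Orientation ℝ (TangentSpace 𝓘(ℝ, ℝ × ℝ) x) (Fin 2)),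
        mem_harmonicForms_iff (k := 0) (m := 2) o :=
  fun H ↦ RoughMetric.not_mem_harmonicForms_iff (H (ℝ × ℝ) RoughMetric.stdOrientation)

/-- **`isSmoothForm_hodgeStar` cannot be discharged as stated** either (the root cause):
`RoughMetric.not_isSmoothForm_hodgeStar`. [folklore] -/
theorem not_forall_isSmoothForm_hodgeStar :
    ¬ ∀ (M : Type) [TopologicalSpace M] [ChartedSpace (ℝ × ℝ) M]
        [RiemannianBundle (fun x : M ↦ TangentSpace 𝓘(ℝ, ℝ × ℝ) x)]
        (o : (x : M) → Orientation ℝ (TangentSpace 𝓘(ℝ, ℝ × ℝ) x) (Fin 2)),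
        isSmoothForm_hodgeStar (k := 1) (m := 1) o :=
  fun H ↦ RoughMetric.not_isSmoothForm_hodgeStar (H (ℝ × ℝ) RoughMetric.stdOrientation)

end Literature.Geometry.Kaehler
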